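import Literature.NumberTheory.PAdicHodge.DeRhamSupersingularRamified
import HarnessLib

/-!
# The explicit-model ramified capstone for ALL admissible cells `(p; e, r₄, r₆)` — `(N1′)` in inequality form (proofs only)

Topic `Literature/NumberTheory/PAdicHodge`; namespace `Literature.NumberTheory.PAdicHodge`. THEOREMS ONLY (no definition, no named
fact, no instance, no `sorry`). Sequel of `DeRhamSupersingularRamified.lean` (p684991, the capstone `hR'` of crux K★
`stmt-BirchSwinnertonDyer-22226`): there the cells are ENUMERATED — `(p; e, r₄, r₆, t₄, t₆) ∈ {(5; 3,1,0,1,0), (5; 6,4,0,2,0), (7; 4,0,2,0,1)}`,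
the three starred potentially supersingular Kodaira types `(5; IV*)`, `(5; II*)`, `(7; III*)`. But the proof uses the cell list at ONE
place only: the ω-period non-vanishing (N1′) `AinfRamTop.omegaPeriod_ne_zero_of_varpi_shape`, whose genuine hypotheses are the
INEQUALITIES `e < 2p − 1` and `e < r + (p − 1)` for the `ϱ`-adic order `r` of the Hasse coefficient (`r = r₄` at `p = 5`, `r = r₆` at
`p = 7`: `hasseCoeff_model_five/seven`). This file re-runs the capstone with the cell hypothesis in that inequality form:

* `AinfRamTop.omegaPeriod_model_five_ne_zero_of_lt` (`0 < r₄`, `e < 9`, `e < r₄ + 4`), `AinfRamTop.omegaPeriod_model_seven_ne_zero_of_lt`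
  (`0 < r₆`, `e < 13`, `e < r₆ + 6`) — (N1′);
* `isDeRham_restrictedRationalTateRep_of_explicitModel_of_etaHom_of_lt`, ★ `isDeRham_restrictedRationalTateRep_of_explicitModel_of_lt` —
  `V_pE` is de Rham for the model `⟨0, 0, 0, a ϱ^{r₄}, b ϱ^{r₆}⟩` over `𝒪_D = ℤ_p[X]/(X^e − p)` (`p ∈ {5, 7}`, `3r₄ = e t₄`, `2r₆ = e t₆`,
  `64a³p^{t₄} + 432b²p^{t₆} ∈ ℤ_pˣ`) under those inequalities.

NEW CELLS covered (consumer: crux TDS57 `stmt-BirchSwinnertonDyer-22227`, the UNSTARRED potentially supersingular types): `(5; IV)` =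
`(5; e = 3, r₄ = 2, t₄ = 2)` (`3 < 2 + 4`). Still outside: `(5; II)` = `(5; 6, 2, 1)` (`6 = 2 + 4`, the canonical-subgroup regime). The
old cells are recovered (`3 < 5`, `6 < 8`; `4 < 8`). BSD / K★ / TDS57 are not proved by any of this.

## References
* [Fontaine1982FormesDifferentielles] J.-M. Fontaine, Invent. Math. 65 (1982), §5.
* [Colmez1992PeriodesAbeliennes] P. Colmez, Math. Ann. 292 (1992), §2.
* [FontaineAsterisque223III] J.-M. Fontaine, Astérisque 223 (1994), Exp. III §1.5.
* [SilvermanAEC2009] J. H. Silverman, *AEC* (2009), IV.7.5, V.4.1, VII.2.2.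
-/

noncomputable section

open scoped Classical
open Field ValuativeRel Polynomial

namespace Literature.NumberTheory.PAdicHodge

open Literature Literature.NumberTheory.GaloisRepresentations Literature.NumberTheory.EllipticCurves
open Literature.NumberTheory.GaloisRepresentations.IsNonarchimedeanLocalField
open Literature.NumberTheory.GaloisRepresentations.LubinTate

/-! ## §1 (N1′) in inequality form -/

namespace AinfRamTop

variable {F : Type} [Field F] [ValuativeRel F] [TopologicalSpace F] [IsNonarchimedeanLocalField F] [CharZero F]

/-- **(N1′) at `5`, inequality form**: for the model `⟨0,0,0,a ϱ^{r₄}, b ϱ^{r₆}⟩` over `𝒪_D = ℤ_5[X]/(X^e − 5)` with `0 < r₄`, `e < 9`,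
`e < r₄ + 4`, `3r₄ = e t₄`, `2r₆ = e t₆`, `64a³5^{t₄} + 432b²5^{t₆} ∈ ℤ_5ˣ`: `∫_t ω ≠ 0` for every `[5]`-compatible `t` with `t₀ = 0`,
`t₁ ≠ 0` (`omegaPeriod_ne_zero_of_varpi_shape` with `r = r₄`, `hasseCoeff_model_five`). Covers `(e, r₄) = (3,1), (6,4)` (K★) and `(3,2)`
(TDS57's `(5; IV)`). [cite: Fontaine1982FormesDifferentielles, §5] [cite: SilvermanAEC2009, IV.7.5] -/
theorem omegaPeriod_model_five_ne_zero_of_lt [Fact (5 : ℕ).Prime] [Fact (¬ IsUnit ((5 : ℕ) : integerC F))]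
    [IsAdicComplete (Ideal.span {((5 : ℕ) : integerC F)}) (integerC F)] {hp : valuation F (5 : ℕ) < 1}
    {D : EisensteinRoot F 5 hp} {hθ : Function.Surjective (WittVector.fontaineTheta (integerC F) 5)} {e : ℕ}
    (hD : D.poly = Polynomial.X ^ e - Polynomial.C ((5 : ℕ) : ℤ_[5])) (a b : ℤ_[5]) {r₄ r₆ t₄ t₆ : ℕ}
    (hr₄ : 0 < r₄) (he9 : e < 9) (her : e < r₄ + 4) (h₄ : 3 * r₄ = e * t₄) (h₆ : 2 * r₆ = e * t₆)
    (hu : IsUnit (64 * a ^ 3 * ((5 : ℕ) : ℤ_[5]) ^ t₄ + 432 * b ^ 2 * ((5 : ℕ) : ℤ_[5]) ^ t₆))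
    {t : ℕ → (maxNilIdealC F).toIdeal} (ht0 : (t 0 : CBall F) = 0)
    (htp : ∀ n, mulPC (((⟨0, 0, 0, AdjoinRoot.of D.poly a * AdjoinRoot.root D.poly ^ r₄,
      AdjoinRoot.of D.poly b * AdjoinRoot.root D.poly ^ r₆⟩ : WeierstrassCurve D.Coeff).map
      (EisensteinRoot.CoeffDisc.of D).toRingHom)) (t (n + 1)) = t n)
    (h1 : (t 1 : CBall F) ≠ 0) :
    omegaPeriod (((⟨0, 0, 0, AdjoinRoot.of D.poly a * AdjoinRoot.root D.poly ^ r₄,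
      AdjoinRoot.of D.poly b * AdjoinRoot.root D.poly ^ r₆⟩ : WeierstrassCurve D.Coeff).map
      (EisensteinRoot.CoeffDisc.of D).toRingHom)) hθ t ht0 htp ≠ 0 := by
  obtain ⟨Q, S, hshape, -, hS⟩ := formalMul_prime_varpi_shape_model (D := D) hD (Or.inl rfl) a b h₄ h₆ hu
    (fun _ => hr₄) (fun h => by norm_num at h)
  obtain ⟨hshape', hS'⟩ := varpi_shape_map_coeffDisc (p := 5) _ hshape hS
  exact omegaPeriod_ne_zero_of_varpi_shape _ hD (by norm_num) hshape' hS' (hasseCoeff_model_five a b r₄ r₆)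
    (by omega) (by omega) ht0 htp h1

/-- **(N1′) at `7`, inequality form**: for the model `⟨0,0,0,a ϱ^{r₄}, b ϱ^{r₆}⟩` over `𝒪_D = ℤ_7[X]/(X^e − 7)` with `0 < r₆`, `e < 13`,
`e < r₆ + 6` (and the unit/numerology conditions): `∫_t ω ≠ 0` for every `[7]`-compatible `t` with `t₀ = 0`, `t₁ ≠ 0`
(`r = r₆`, `hasseCoeff_model_seven`). [cite: Fontaine1982FormesDifferentielles, §5] [cite: SilvermanAEC2009, IV.7.5] -/
theorem omegaPeriod_model_seven_ne_zero_of_lt [Fact (7 : ℕ).Prime] [Fact (¬ IsUnit ((7 : ℕ) : integerC F))]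
    [IsAdicComplete (Ideal.span {((7 : ℕ) : integerC F)}) (integerC F)] {hp : valuation F (7 : ℕ) < 1}
    {D : EisensteinRoot F 7 hp} {hθ : Function.Surjective (WittVector.fontaineTheta (integerC F) 7)} {e : ℕ}
    (hD : D.poly = Polynomial.X ^ e - Polynomial.C ((7 : ℕ) : ℤ_[7])) (a b : ℤ_[7]) {r₄ r₆ t₄ t₆ : ℕ}
    (hr₆ : 0 < r₆) (he13 : e < 13) (her : e < r₆ + 6) (h₄ : 3 * r₄ = e * t₄) (h₆ : 2 * r₆ = e * t₆)
    (hu : IsUnit (64 * a ^ 3 * ((7 : ℕ) : ℤ_[7]) ^ t₄ + 432 * b ^ 2 * ((7 : ℕ) : ℤ_[7]) ^ t₆))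
    {t : ℕ → (maxNilIdealC F).toIdeal} (ht0 : (t 0 : CBall F) = 0)
    (htp : ∀ n, mulPC (((⟨0, 0, 0, AdjoinRoot.of D.poly a * AdjoinRoot.root D.poly ^ r₄,
      AdjoinRoot.of D.poly b * AdjoinRoot.root D.poly ^ r₆⟩ : WeierstrassCurve D.Coeff).map
      (EisensteinRoot.CoeffDisc.of D).toRingHom)) (t (n + 1)) = t n)
    (h1 : (t 1 : CBall F) ≠ 0) :
    omegaPeriod (((⟨0, 0, 0, AdjoinRoot.of D.poly a * AdjoinRoot.root D.poly ^ r₄,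
      AdjoinRoot.of D.poly b * AdjoinRoot.root D.poly ^ r₆⟩ : WeierstrassCurve D.Coeff).map
      (EisensteinRoot.CoeffDisc.of D).toRingHom)) hθ t ht0 htp ≠ 0 := by
  obtain ⟨Q, S, hshape, -, hS⟩ := formalMul_prime_varpi_shape_model (D := D) hD (Or.inr rfl) a b h₄ h₆ hu
    (fun h => by norm_num at h) (fun _ => hr₆)
  obtain ⟨hshape', hS'⟩ := varpi_shape_map_coeffDisc (p := 7) _ hshape hS
  exact omegaPeriod_ne_zero_of_varpi_shape _ hD (by norm_num) hshape' hS' (hasseCoeff_model_seven a b r₄ r₆)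
    (by omega) (by omega) ht0 htp h1

end AinfRamTop

/-! ## §2 The capstone for all admissible cells -/

variable {F : Type} [Field F] [ValuativeRel F] [TopologicalSpace F] [IsNonarchimedeanLocalField F] [CharZero F]
  {p : ℕ} [Fact p.Prime] [Fact (¬ IsUnit (p : integerC F))] [IsAdicComplete (Ideal.span {(p : integerC F)}) (integerC F)]

/-- **The explicit-model capstone modulo the η-period, inequality form** — verbatim
`isDeRham_restrictedRationalTateRep_of_explicitModel_of_etaHom` with the enumerated cell hypothesis replaced by: `p ∈ {5, 7}`,
`0 < r₄` and `e < 9`, `e < r₄ + 4` at `p = 5`, `0 < r₆` and `e < 13`, `e < r₆ + 6` at `p = 7` (the (N1′) inequalities).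
[cite: Fontaine1982FormesDifferentielles, §5] [cite: Colmez1992PeriodesAbeliennes, §2] [cite: SilvermanAEC2009, VII.2.2] -/
theorem isDeRham_restrictedRationalTateRep_of_explicitModel_of_etaHom_of_lt
    (hp : valuation F p < 1) [Algebra ℚ_[p] F] (D : EisensteinRoot F p hp) {e : ℕ} (hD : D.poly = X ^ e - C (p : ℤ_[p]))
    {K₀ : Type} [Field K₀] [CharZero K₀] [Algebra K₀ F] (W₀ : WeierstrassCurve K₀) [W₀.IsElliptic]
    (a b : ℤ_[p]) (r₄ r₆ t₄ t₆ : ℕ) (hp57 : p = 5 ∨ p = 7)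
    (h5 : p = 5 → 0 < r₄ ∧ e < 9 ∧ e < r₄ + 4) (h7 : p = 7 → 0 < r₆ ∧ e < 13 ∧ e < r₆ + 6)
    (h₄ : 3 * r₄ = e * t₄) (h₆ : 2 * r₆ = e * t₆) (hu : IsUnit (64 * a ^ 3 * (p : ℤ_[p]) ^ t₄ + 432 * b ^ 2 * (p : ℤ_[p]) ^ t₆))
    (hW : W₀.baseChange F = (⟨0, 0, 0, AdjoinRoot.of D.poly a * AdjoinRoot.root D.poly ^ r₄,
      AdjoinRoot.of D.poly b * AdjoinRoot.root D.poly ^ r₆⟩ : WeierstrassCurve D.Coeff).map (EisensteinRoot.Coeff.toF D))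
    (ψ : EisensteinRoot.CoeffDisc D →+* LTCoeff F) (hψ : ∀ c, algebraMap (LTCoeff F) F (ψ c) = EisensteinRoot.CoeffDisc.toF D c)
    (φ₂ : AinfTop.TatePtO F ((((⟨0, 0, 0, AdjoinRoot.of D.poly a * AdjoinRoot.root D.poly ^ r₄,
      AdjoinRoot.of D.poly b * AdjoinRoot.root D.poly ^ r₆⟩ : WeierstrassCurve D.Coeff).map
      (EisensteinRoot.CoeffDisc.of D).toRingHom)).map ψ) p →+ BdRPlusTop F p)
    (hφ₂s : ∀ (c : ℤ_[p]) τ, φ₂ (c • τ) = BdRPlusTop.of F p (qpToBdR (c : ℚ_[p])) * φ₂ τ)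
    (hφ₂g : ∀ (σ : absoluteGaloisGroup F) τ, BdRPlusTop.gal F p σ (φ₂ τ) = φ₂ (σ • τ))
    (hNη : ∃ τ, φ₂ τ ∉ (BdRPlusTop.filOne F p).toIdeal) :
    GaloisRep.IsDeRham (bdRPeriodRingData (F := F) (p := p) hp) (restrictedRationalTateRep W₀ F p) := by
  have hθ : Function.Surjective (WittVector.fontaineTheta (integerC F) p) := surjective_fontaineTheta_integerC hp
  have hp2 : p ≠ 2 := by rcases hp57 with rfl | rfl <;> norm_num
  have hr₄ : p = 5 → 0 < r₄ := fun h => (h5 h).1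
  have hr₆ : p = 7 → 0 < r₆ := fun h => (h7 h).1
  -- the residue characteristic
  haveI : CharP 𝓀[F] p := by
    refine (CharP.charP_iff_prime_eq_zero Fact.out).2 ?_
    rw [← map_natCast (IsLocalRing.residue 𝒪[F]), IsLocalRing.residue_eq_zero_iff, IsLocalRing.mem_maximalIdeal,
      mem_nonunits_iff, (Valuation.integer.integers (valuation F)).isUnit_iff_valuation_eq_one]
    rw [map_natCast]
    exact hp.ne
  -- the reduction data of `W♭ = W_D ⊗_β 𝒪_F = W ⊗_ψ 𝒪_F`, `β = ψ ∘ of`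
  have hΔ := AinfTop.isUnit_Δ_map_model (F := F) hD (ψ.comp (EisensteinRoot.CoeffDisc.of D).toRingHom) a b h₄ h₆ hu
  have hA := AinfTop.hasseCoeff_red_map_model_eq_zero hD (ψ.comp (EisensteinRoot.CoeffDisc.of D).toRingHom) a b hp57 hr₄ hr₆
  -- `W₀ ×_{K₀} F = (W ⊗_ψ 𝒪_F) ⊗ F`
  have hW' := hW.trans (AinfRamTop.curveFO_map_of_map_ψ _ ψ hψ).symm
  -- the Tate-module witness `τ₁ ≠ 0`
  obtain ⟨τ, hτ1, -⟩ :=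
    AinfTop.exists_tatePtO_norm_p_lt_norm_pow_model hD (ψ.comp (EisensteinRoot.CoeffDisc.of D).toRingHom) a b hp57 h₄ h₆ hu hr₄ hr₆
  -- (N1′): `∫_t ω ≠ 0` whenever `t₁ ≠ 0`, in inequality form
  have hN1seq : ∀ {t : ℕ → (maxNilIdealC F).toIdeal} (ht0 : (t 0 : CBall F) = 0)
      (htp : ∀ n, AinfRamTop.mulPC (((⟨0, 0, 0, AdjoinRoot.of D.poly a * AdjoinRoot.root D.poly ^ r₄,
        AdjoinRoot.of D.poly b * AdjoinRoot.root D.poly ^ r₆⟩ : WeierstrassCurve D.Coeff).map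
        (EisensteinRoot.CoeffDisc.of D).toRingHom)) (t (n + 1)) = t n),
      (t 1 : CBall F) ≠ 0 → AinfRamTop.omegaPeriod _ hθ t ht0 htp ≠ 0 := by
    intro t ht0 htp h1
    rcases hp57 with rfl | rfl
    · obtain ⟨hr, he, her⟩ := h5 rfl
      exact AinfRamTop.omegaPeriod_model_five_ne_zero_of_lt hD a b hr he her h₄ h₆ hu ht0 htp h1
    · obtain ⟨hr, he, her⟩ := h7 rfl
      exact AinfRamTop.omegaPeriod_model_seven_ne_zero_of_lt hD a b hr he her h₄ h₆ hu ht0 htp h1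
  have hN1 := AinfRamTop.exists_omegaPeriodHomO_ne_zero _ ψ (hψ := hψ) hN1seq ⟨τ, hτ1⟩
  -- socket
  exact isDeRham_restrictedRationalTateRep_of_periodHomsO hp W₀ _ hW' hp2 hΔ hA
    (AinfRamTop.omegaPeriodHomO _ ψ hθ hψ) φ₂ (AinfRamTop.omegaPeriodHomO_smul' _ ψ) hφ₂s
    (AinfRamTop.gal_omegaPeriodHomO _ ψ) hφ₂g (AinfRamTop.omegaPeriodHomO_mem_filOne _ ψ) hN1 hNη

/-- ★ **`V_pE` is de Rham for the explicit good supersingular `𝒪_D`-models, ALL admissible cells.** Let `D = (X^e − p, ϖ)` be an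
Eisenstein datum of the `p`-adic field `F` (`p ∈ {5, 7}`), `W_D = ⟨0, 0, 0, a ϱ^{r₄}, b ϱ^{r₆}⟩` over `𝒪_D` with `3r₄ = e t₄`, `2r₆ = e t₆`,
`64a³p^{t₄} + 432b²p^{t₆} ∈ ℤ_pˣ` and the (N1′) inequalities (`0 < r₄`, `e < 9`, `e < r₄ + 4` at `5`; `0 < r₆`, `e < 13`, `e < r₆ + 6` at `7`),
and `W₀/K₀` with `W₀ ×_{K₀} F = W_D ⊗_{𝒪_D} F`. Then `restrictedRationalTateRep W₀ F p` is de Rham for `bdRPeriodRingData hp` — the proof of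
`isDeRham_restrictedRationalTateRep_of_explicitModel` verbatim (`∫η` and its transversality at the Tate-module witness `‖p‖ < ‖τ₁‖^p`).
Covers the K★ cells `(5; 3,1), (5; 6,4), (7; 4,·,2)` and TDS57's `(5; IV) = (5; 3, 2)`, `(7; III) = (7; 4,·,2)`.
[cite: Fontaine1982FormesDifferentielles, §5] [cite: Colmez1992PeriodesAbeliennes, §2] [cite: FontaineAsterisque223III, Exp. III Thm. 1.5.2]
[cite: SilvermanAEC2009, IV.7.5 and VII.2.2] -/
theorem isDeRham_restrictedRationalTateRep_of_explicitModel_of_lt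
    (hp : valuation F p < 1) [Algebra ℚ_[p] F] (D : EisensteinRoot F p hp) {e : ℕ} (hD : D.poly = Polynomial.X ^ e - Polynomial.C (p : ℤ_[p]))
    {K₀ : Type} [Field K₀] [CharZero K₀] [Algebra K₀ F] (W₀ : WeierstrassCurve K₀) [W₀.IsElliptic]
    (a b : ℤ_[p]) (r₄ r₆ t₄ t₆ : ℕ) (hp57 : p = 5 ∨ p = 7)
    (h5 : p = 5 → 0 < r₄ ∧ e < 9 ∧ e < r₄ + 4) (h7 : p = 7 → 0 < r₆ ∧ e < 13 ∧ e < r₆ + 6)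
    (h₄ : 3 * r₄ = e * t₄) (h₆ : 2 * r₆ = e * t₆) (hu : IsUnit (64 * a ^ 3 * (p : ℤ_[p]) ^ t₄ + 432 * b ^ 2 * (p : ℤ_[p]) ^ t₆))
    (hW : W₀.baseChange F = (⟨0, 0, 0, AdjoinRoot.of D.poly a * AdjoinRoot.root D.poly ^ r₄,
      AdjoinRoot.of D.poly b * AdjoinRoot.root D.poly ^ r₆⟩ : WeierstrassCurve D.Coeff).map (EisensteinRoot.Coeff.toF D)) :
    GaloisRep.IsDeRham (bdRPeriodRingData (F := F) (p := p) hp) (restrictedRationalTateRep W₀ F p) := by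
  have hθ : Function.Surjective (WittVector.fontaineTheta (integerC F) p) := surjective_fontaineTheta_integerC hp
  -- the bridge `ψ : 𝒪_D → 𝒪_F`
  obtain ⟨ψ, hψ⟩ : ∃ ψ : EisensteinRoot.CoeffDisc D →+* LTCoeff F,
      ∀ c, algebraMap (LTCoeff F) F (ψ c) = EisensteinRoot.CoeffDisc.toF D c := by
    obtain ⟨β, hβ⟩ := EisensteinRoot.exists_coeffToLTCoeff D
    exact ⟨β.comp (EisensteinRoot.CoeffDisc.of D).symm.toRingHom, fun c => hβ _⟩
  have hp2 : p ≠ 2 := by rcases hp57 with rfl | rfl <;> norm_num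
  have hr₄ : p = 5 → 0 < r₄ := fun h => (h5 h).1
  have hr₆ : p = 7 → 0 < r₆ := fun h => (h7 h).1
  -- the residue characteristic
  haveI : CharP 𝓀[F] p := by
    refine (CharP.charP_iff_prime_eq_zero Fact.out).2 ?_
    rw [← map_natCast (IsLocalRing.residue 𝒪[F]), IsLocalRing.residue_eq_zero_iff, IsLocalRing.mem_maximalIdeal,
      mem_nonunits_iff, (Valuation.integer.integers (valuation F)).isUnit_iff_valuation_eq_one]
    rw [map_natCast]
    exact hp.ne
  -- reduction data and the Tate-module witness of `W♭ = W_D ⊗_{ψ ∘ of} 𝒪_F`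
  have hΔ := AinfTop.isUnit_Δ_map_model (F := F) hD (ψ.comp (EisensteinRoot.CoeffDisc.of D).toRingHom) a b h₄ h₆ hu
  have hA := AinfTop.hasseCoeff_red_map_model_eq_zero hD (ψ.comp (EisensteinRoot.CoeffDisc.of D).toRingHom) a b hp57 hr₄ hr₆
  obtain ⟨τ, -, hτp⟩ :=
    AinfTop.exists_tatePtO_norm_p_lt_norm_pow_model hD (ψ.comp (EisensteinRoot.CoeffDisc.of D).toRingHom) a b hp57 h₄ h₆ hu hr₄ hr₆
  -- (Nη′): `∫_τ η ∉ Fil¹`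
  have hNη := AinfRamTop.exists_etaPeriodHomO_not_mem_filOne (hθ := hθ)
    (((⟨0, 0, 0, AdjoinRoot.of D.poly a * AdjoinRoot.root D.poly ^ r₄, AdjoinRoot.of D.poly b * AdjoinRoot.root D.poly ^ r₆⟩ :
      WeierstrassCurve D.Coeff).map (EisensteinRoot.CoeffDisc.of D).toRingHom)) ψ hψ hp2 hΔ hA ⟨τ, hτp⟩
  -- assembly
  exact isDeRham_restrictedRationalTateRep_of_explicitModel_of_etaHom_of_lt hp D hD W₀ a b r₄ r₆ t₄ t₆ hp57 h5 h7 h₄ h₆ hu hW ψ hψ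
    (AinfRamTop.etaPeriodHomO _ ψ hθ hψ) (AinfRamTop.etaPeriodHomO_smul' _ ψ) (AinfRamTop.gal_etaPeriodHomO _ ψ) hNη

end Literature.NumberTheory.PAdicHodge

end
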